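import Literature.MathematicalPhysics.QuantumManyBody.GroundState
import HarnessLib

/-!
# Route `BECCutLineWeakDisorder`, crux `GroundStateRigidity` (stmt-AtomisticToContinuum-9072),
# line `Sketch`: the registered stub `stub_rigidityOfUnique`

Supports (does not close) stmt-AtomisticToContinuum-9072. **Rigidity from uniqueness, given
compactness** (Reed–Simon IV §XIII.12 with Thm XIII.64): IF every bounded-energy sequence of
admissible trial states has a subsequence converging in `L²((ℝ³)^N)` to a measurable, Dirichlet,
Bose-symmetric function (the registered statement of the neighbouring stub `stub_compactness`,
taken here as the ANTECEDENT of an implication and not re-proved), THEN at every `(v, N, L)` with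
a nondegenerate closed-form ground state (`HasUniqueGroundState v N L`) near-minimisers of the
Dirichlet energy are mutually `L²`-close up to a constant phase: for every `η > 0` there is
`δ > 0` such that any two trial states with energies `≤ E₀ + δ` are `η`-close in `L²` after
rotating one of them by some `c`, `|c| = 1`.

## Proof (by contradiction, two successive subsequences)

If not, with `δₙ = 1/(n+1)` there are `δₙ`-near-minimisers `Ψₙ`, `Φₙ` with
`∫ |Ψₙ - c Φₙ|² > η` for EVERY phase `c`. The energies are `≤ E₀ + 1 < ⊤`
(`E₀ < ⊤` because a ground state exists), so compactness gives a subsequence `φ₁` along which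
`Ψ → f` in `L²`, and again a subsequence `φ₂` along which `Φ ∘ φ₁ → g`; along `φ = φ₁ ∘ φ₂` both
converge. Since `E₀ + δ_{φ n} → E₀`, the `liminf` of the energies along `φ` is `≤ E₀`, so `f` and
`g` are ground states (`IsGroundState.of_tendstoL2`), whence `f = c g` a.e. for a phase `c`
(uniqueness). Then `|Ψ_{φ n} - c Φ_{φ n}|² ≤ 2|Ψ_{φ n} - f|² + 2|Φ_{φ n} - g|²` a.e. (as
`f - c Φ = c (g - Φ)` and `|c| = 1`), so `∫ |Ψ_{φ n} - c Φ_{φ n}|² → 0 < η`: contradiction.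
-/

noncomputable section

open MeasureTheory Filter
open scoped ENNReal NNReal Topology

namespace Summit.AtomisticToContinuum.BoseEinsteinCondensation.Theorems.GroundStateRigidity

open Literature.MathematicalPhysics.QuantumManyBody.BoseGas

/-! ### Bookkeeping lemmas -/

/-- `|a + b|² ≤ 2|a|² + 2|b|²` for complex numbers, in `ℝ≥0∞`. [folklore] -/
theorem coe_nnnorm_add_sq_le (a b : ℂ) :
    (‖a + b‖₊ : ℝ≥0∞) ^ 2 ≤ 2 * (‖a‖₊ : ℝ≥0∞) ^ 2 + 2 * (‖b‖₊ : ℝ≥0∞) ^ 2 := by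
  have h : ‖a + b‖₊ ^ 2 ≤ 2 * ‖a‖₊ ^ 2 + 2 * ‖b‖₊ ^ 2 := by
    rw [← NNReal.coe_le_coe]
    push_cast
    have h1 : ‖a + b‖ ≤ ‖a‖ + ‖b‖ := norm_add_le a b
    have h2 : ‖a + b‖ ^ 2 ≤ (‖a‖ + ‖b‖) ^ 2 := by
      have h0 : 0 ≤ ‖a + b‖ := norm_nonneg _
      nlinarith [h1, h0]
    nlinarith [h2, sq_nonneg (‖a‖ - ‖b‖)]
  exact_mod_cast h

/-- A vanishing sequence of positive tolerances `δₙ = 1/(n+1) ∈ (0, 1]`. [folklore] -/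
theorem exists_tolerances :
    ∃ δ : ℕ → ℝ≥0∞, (∀ n, 0 < δ n) ∧ (∀ n, δ n ≤ 1) ∧ Tendsto δ atTop (𝓝 0) := by
  refine ⟨fun n => ((n + 1 : ℕ) : ℝ≥0∞)⁻¹, fun n => ?_, fun n => ?_, ?_⟩
  · exact ENNReal.inv_pos.2 (ENNReal.natCast_ne_top _)
  · exact ENNReal.inv_le_one.2 (by exact_mod_cast Nat.le_add_left 1 n)
  · exact ENNReal.tendsto_inv_nat_nhds_zero.comp (tendsto_add_atTop_nat 1)

/-- **`L²` bookkeeping for the contradiction.** If `Ψₙ → f` and `Φₙ → g` in `L²` and `f = c g`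
a.e. with `|c| = 1`, then `∫ |Ψₙ - c Φₙ|² → 0`
(`|Ψₙ - c Φₙ|² ≤ 2|Ψₙ - f|² + 2|Φₙ - g|²` a.e.). [folklore] -/
theorem tendsto_lintegral_sub_const_mul {N : ℕ} {L : ℝ} {Ψ Φ : ℕ → TrialState N L}
    {f g : Config N → ℂ} (hfm : Measurable f) (hΨ : TendstoL2 Ψ f) (hΦ : TendstoL2 Φ g)
    {c : ℂ} (hc : ‖c‖ = 1) (hae : ∀ᵐ X : Config N, f X = c * g X) :
    Tendsto (fun n => ∫⁻ X, (‖(Ψ n).ψ X - c * (Φ n).ψ X‖₊ : ℝ≥0∞) ^ 2) atTop (𝓝 0) := by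
  have hmeas : ∀ n, Measurable fun X => 2 * (‖(Ψ n).ψ X - f X‖₊ : ℝ≥0∞) ^ 2 := fun n =>
    (((Ψ n).contDiff.continuous.measurable.sub hfm).nnnorm.coe_nnreal_ennreal.pow_const
      2).const_mul 2
  have hle : ∀ n, ∫⁻ X, (‖(Ψ n).ψ X - c * (Φ n).ψ X‖₊ : ℝ≥0∞) ^ 2 ≤
      2 * (∫⁻ X, (‖(Ψ n).ψ X - f X‖₊ : ℝ≥0∞) ^ 2) +
        2 * (∫⁻ X, (‖(Φ n).ψ X - g X‖₊ : ℝ≥0∞) ^ 2) := by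
    intro n
    have h1 : ∫⁻ X, (‖(Ψ n).ψ X - c * (Φ n).ψ X‖₊ : ℝ≥0∞) ^ 2 ≤
        ∫⁻ X, 2 * (‖(Ψ n).ψ X - f X‖₊ : ℝ≥0∞) ^ 2 + 2 * (‖(Φ n).ψ X - g X‖₊ : ℝ≥0∞) ^ 2 := by
      refine lintegral_mono_ae ?_
      filter_upwards [hae] with X hX
      have e : (Ψ n).ψ X - c * (Φ n).ψ X = ((Ψ n).ψ X - f X) + c * (g X - (Φ n).ψ X) := by
        rw [hX]
        ring
      rw [e]
      refine (coe_nnnorm_add_sq_le _ _).trans_eq ?_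
      rw [nnnorm_mul, ENNReal.coe_mul, coe_nnnorm_eq_one_of_norm_eq_one hc, one_mul,
        ← neg_sub ((Φ n).ψ X) (g X), nnnorm_neg]
    rw [lintegral_add_left (hmeas n), lintegral_const_mul' _ _ ENNReal.ofNat_ne_top,
      lintegral_const_mul' _ _ ENNReal.ofNat_ne_top] at h1
    exact h1
  have hlim : Tendsto (fun n => 2 * (∫⁻ X, (‖(Ψ n).ψ X - f X‖₊ : ℝ≥0∞) ^ 2) +
      2 * (∫⁻ X, (‖(Φ n).ψ X - g X‖₊ : ℝ≥0∞) ^ 2)) atTop (𝓝 0) := by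
    have h2 : (0 : ℝ≥0∞) ≠ 0 ∨ (2 : ℝ≥0∞) ≠ ∞ := Or.inr ENNReal.ofNat_ne_top
    have h := (ENNReal.Tendsto.const_mul hΨ h2).add (ENNReal.Tendsto.const_mul hΦ h2)
    rw [mul_zero, add_zero] at h
    exact h
  exact tendsto_of_tendsto_of_tendsto_of_le_of_le tendsto_const_nhds hlim (fun _ => zero_le) hle

/-! ### The stub -/

/-- **Stub 1 of line `Sketch` — rigidity from uniqueness, given compactness.** If bounded-energy
sequences of trial states are `L²`-precompact with measurable, Dirichlet, Bose-symmetric limits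
(the antecedent: the registered statement of `stub_compactness`), then at every `(v, N, L)` with
a unique closed-form ground state (`HasUniqueGroundState v N L`), near-minimisers of the energy are
mutually `L²`-close up to a constant phase: for every `η > 0` some `δ > 0` makes any two trial
states of energy `≤ E₀ + δ` satisfy `∫ |Ψ - c Φ|² ≤ η` for some `|c| = 1`. Proof by contradiction:
two sequences of `1/(n+1)`-near-minimisers staying `η`-apart modulo phase have (two successive)
subsequences converging to ground states `f`, `g` (`IsGroundState.of_tendstoL2`), `f = c g` a.e.
by uniqueness, and `∫ |Ψₙ - c Φₙ|² → 0`, a contradiction.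
[cite: ReedSimonIV1978, §XIII.12 Thm XIII.47] -/
theorem stub_rigidityOfUnique :
    (∀ (N : ℕ) (L : ℝ) (v : ℝ → ℝ≥0∞) (E : ℝ≥0∞) (Φ : ℕ → TrialState N L), E ≠ ⊤ →
      (∀ n, energy v (Φ n) ≤ E) →
      ∃ (Ψ : Config N → ℂ) (φ : ℕ → ℕ), StrictMono φ ∧ Measurable Ψ ∧
        (∀ X, X ∉ boxN N L → Ψ X = 0) ∧
        (∀ (σ : Equiv.Perm (Fin N)) (X : Config N), Ψ (X ∘ σ) = Ψ X) ∧
        TendstoL2 (fun n => Φ (φ n)) Ψ) →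
    ∀ (v : ℝ → ℝ≥0∞) (N : ℕ) (L : ℝ), HasUniqueGroundState v N L →
      ∀ η : ℝ, 0 < η → ∃ δ : ℝ≥0∞, 0 < δ ∧ ∀ Ψ Φ : TrialState N L,
        energy v Ψ ≤ groundStateEnergy v N L + δ → energy v Φ ≤ groundStateEnergy v N L + δ →
        ∃ c : ℂ, ‖c‖ = 1 ∧ ∫⁻ X, (‖Ψ.ψ X - c * Φ.ψ X‖₊ : ℝ≥0∞) ^ 2 ≤ ENNReal.ofReal η := by
  intro hC v N L hU η hη
  have hE0 : groundStateEnergy v N L ≠ ⊤ :=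
    hU.isGroundState_groundState.groundStateEnergy_ne_top
  by_contra hcon
  push Not at hcon
  -- sequences of `δₙ`-near-minimisers staying `η`-apart modulo phase
  obtain ⟨δ, hδpos, hδle, hδ0⟩ := exists_tolerances
  choose Ψs Φs hΨe hΦe hfar using fun n => hcon (δ n) (hδpos n)
  -- uniform energy bound `E₀ + 1 < ⊤`
  have hEtop : groundStateEnergy v N L + 1 ≠ ⊤ :=
    ENNReal.add_ne_top.2 ⟨hE0, ENNReal.one_ne_top⟩
  have hΨb : ∀ n, energy v (Ψs n) ≤ groundStateEnergy v N L + 1 := fun n =>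
    (hΨe n).trans (add_le_add le_rfl (hδle n))
  -- first subsequence: `Ψ ∘ φ₁ → f`
  obtain ⟨f, φ₁, hφ₁, hfm, hf0, hfσ, hf⟩ := hC N L v _ Ψs hEtop hΨb
  -- second subsequence: `Φ ∘ φ₁ ∘ φ₂ → g`
  have hΦb : ∀ n, energy v (Φs (φ₁ n)) ≤ groundStateEnergy v N L + 1 := fun n =>
    (hΦe (φ₁ n)).trans (add_le_add le_rfl (hδle _))
  obtain ⟨g, φ₂, hφ₂, hgm, hg0, hgσ, hg⟩ := hC N L v _ (fun n => Φs (φ₁ n)) hEtop hΦb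
  -- along `φ = φ₁ ∘ φ₂` both sequences converge
  have hφ : StrictMono (φ₁ ∘ φ₂) := hφ₁.comp hφ₂
  have hf' : TendstoL2 (fun n => Ψs (φ₁ (φ₂ n))) f := by
    have h := Tendsto.comp hf hφ₂.tendsto_atTop
    exact h
  have hg' : TendstoL2 (fun n => Φs (φ₁ (φ₂ n))) g := hg
  -- the `liminf` of the energies along `φ` is `≤ E₀`
  have hup : Tendsto (fun n => groundStateEnergy v N L + δ (φ₁ (φ₂ n))) atTop
      (𝓝 (groundStateEnergy v N L)) := by
    have h := (hδ0.comp hφ.tendsto_atTop).const_add (groundStateEnergy v N L)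
    rw [add_zero] at h
    exact h
  have hlimΨ : liminf (fun n => energy v (Ψs (φ₁ (φ₂ n)))) atTop ≤ groundStateEnergy v N L :=
    (liminf_le_liminf (Eventually.of_forall fun n => hΨe (φ₁ (φ₂ n)))).trans hup.liminf_eq.le
  have hlimΦ : liminf (fun n => energy v (Φs (φ₁ (φ₂ n)))) atTop ≤ groundStateEnergy v N L :=
    (liminf_le_liminf (Eventually.of_forall fun n => hΦe (φ₁ (φ₂ n)))).trans hup.liminf_eq.le
  -- the limits are ground states, hence proportional by a phase
  have hfG : IsGroundState v L f := IsGroundState.of_tendstoL2 hfm hf0 hfσ hE0 hf' hlimΨ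
  have hgG : IsGroundState v L g := IsGroundState.of_tendstoL2 hgm hg0 hgσ hE0 hg' hlimΦ
  obtain ⟨c, hc, hae⟩ := hU.2 g f hgG hfG
  -- `∫ |Ψ_{φ n} - c Φ_{φ n}|² → 0`, contradicting `> η` for every `n`
  have ht := tendsto_lintegral_sub_const_mul hfm hf' hg' hc hae
  have hη' : (0 : ℝ≥0∞) < ENNReal.ofReal η := ENNReal.ofReal_pos.2 hη
  obtain ⟨n, hn⟩ := ((tendsto_order.1 ht).2 _ hη').exists
  exact lt_asymm hn (hfar (φ₁ (φ₂ n)) c hc)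

end Summit.AtomisticToContinuum.BoseEinsteinCondensation.Theorems.GroundStateRigidity

end
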